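import Mathlib
import Literature.Analysis.FluidPDE.VectorCalculus
import Literature.Analysis.FluidPDE.VorticityStretching
import Literature.Analysis.FluidPDE.LerayProfileCalculus
import Literature.Analysis.FluidPDE.EnstrophySplitting
import Summits.NavierStokesRegularity.NavierStokesRegularity.Theorems.ThreadingFluxErtelTowerKinematicRigidity
import HarnessLib

/-!
# Crux `PoloidalLiouville` (stmt-NavierStokesRegularity-1222, W1), crux idea «radial-jerk-tower» (ns-idea-15 g7):
# LOCAL LAPLACIAN TOOLKIT for the viscous levels of the tower

Support file (`--supports stmt-NavierStokesRegularity-1222`, helper).  Experiment cell `ns-wall-extremal`, width hand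
ns-wall-eng-5 g6, director KEY-NS #186; critic of record ns-wall-crit-1 g4.  0 kit.

The sketch's viscous statements (`ViscousLevelTwoLaw`, ErtelTowerSketch v1.1 Part B) live on an OPEN space-time set
`I × U` with slices smooth on `U` only, while the tree's Laplacian identities (`laplacian_inner_eq`, `curl_laplacian`,
`fderiv_laplacian_apply_of_contDiff_three`, …) are stated for GLOBALLY `C²`/`C³` fields.  This file bridges the two by a
smooth cut-off and the locality of `Δ`, `curl`, `∇`:

* `exists_contDiff_eventuallyEq` — a `Cⁿ` function on an open `U ∋ x` agrees near `x` with a globally `Cⁿ` one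
  (general codomain; the tree has the `ℝⁿ → ℝⁿ` and scalar forms); `curl_congr_nhds`, `gradient_congr_nhds`,
  `contDiffOn_slice`;
* local forms: `curl_laplacian_of_contDiffOn` (`curl Δ = Δ curl`), `laplacian_inner_of_contDiffOn` (Leibniz rule for
  `Δ⟪F,G⟫` in the standard frame), `laplacian_inner_sub_const_of_contDiffOn` (`Δ⟪B, y − x₀⟫ = ⟪ΔB, x − x₀⟫ + 2 div B`),
  `laplacian_gradient_of_contDiffOn` (`Δ∇ = ∇Δ`);
* coordinates: `gradient_apply_coord`, `fderiv_apply_coord`, `sum_inner_fderiv_gradient_eq`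
  (`Σᵢ ⟪∂ᵢω, ∂ᵢ∇m⟫ = Σᵢⱼ (∂ᵢωⱼ)(∂ᵢ∂ⱼm)`, the right-hand side of `ViscousLevelTwoLaw` as typed).

Pure calculus; no statement about the wall.  `PoloidalLiouville` (1222) / (27585) OPEN; NS regularity NOT proved.
-/

-- the summit and its single problem share the name (D-0017 nested layout)
set_option linter.dupNamespace false

noncomputable section

namespace Summit.NavierStokesRegularity.NavierStokesRegularity.Theorems.PoloidalLiouville.ErtelTower

open Set Function Filter Topology Metric
open scoped Topology RealInnerProductSpace InnerProductSpace
open Literature.Analysis.FluidPDE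
open Summit.NavierStokesRegularity.NavierStokesRegularity.Theorems.PoloidalLiouville.HorizonTower (E3)

/-! ### Smooth localisation and the locality of `Δ`, `curl`, `∇` -/

section Localisation

variable {F' : Type*} [NormedAddCommGroup F'] [NormedSpace ℝ F'] {U : Set E3} {x : E3}

/-- **Smooth cut-off**: a function of class `Cⁿ` on an open `U ∋ x` agrees near `x` with a globally `Cⁿ` function
(multiply by a bump function which is `1` near `x` and supported in `U`).  General-codomain form of the tree's
`exists_contDiff_eventuallyEq_of_contDiffOn` (FourManifolds, `ℝⁿ → ℝⁿ`) and `exists_contDiff_eqOn_ball` (scalar). -/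
theorem exists_contDiff_eventuallyEq {f : E3 → F'} {n : ℕ∞} (hU : IsOpen U) (hf : ContDiffOn ℝ n f U)
    (hx : x ∈ U) : ∃ g : E3 → F', ContDiff ℝ n g ∧ f =ᶠ[𝓝 x] g := by
  obtain ⟨r, hr0, hrU⟩ := Metric.isOpen_iff.1 hU x hx
  let φ : ContDiffBump x := ⟨r / 4, r / 2, by positivity, by linarith⟩
  refine ⟨fun y => φ y • f y, ?_, ?_⟩
  · rw [contDiff_iff_contDiffAt]
    intro y
    by_cases hy : y ∈ U
    · exact φ.contDiffAt.smul (hf.contDiffAt (hU.mem_nhds hy))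
    · have hy' : y ∉ tsupport φ := by
        rw [φ.tsupport_eq]
        intro hy'
        exact hy (hrU (Metric.closedBall_subset_ball (by show r / 2 < r; linarith) hy'))
      have h0 : (φ : E3 → ℝ) =ᶠ[𝓝 y] 0 := notMem_tsupport_iff_eventuallyEq.1 hy'
      have h0' : (fun z => φ z • f z) =ᶠ[𝓝 y] fun _ => 0 := by
        filter_upwards [h0] with z hz
        simp [hz]
      exact contDiffAt_const.congr_of_eventuallyEq h0'
  · filter_upwards [φ.eventuallyEq_one] with y hy
    simp [hy]

/-- The curl is local: fields agreeing near `x` have curls agreeing near `x`. -/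
theorem curl_congr_nhds {f g : E3 → E3} (h : f =ᶠ[𝓝 x] g) : curl f =ᶠ[𝓝 x] curl g := by
  filter_upwards [h.fderiv (𝕜 := ℝ)] with y hy
  rw [curl_eq_curlCLM, curl_eq_curlCLM, hy]

/-- The gradient is local. -/
theorem gradient_congr_nhds {f g : E3 → ℝ} (h : f =ᶠ[𝓝 x] g) : gradient f =ᶠ[𝓝 x] gradient g := by
  filter_upwards [h.fderiv (𝕜 := ℝ)] with y hy
  rw [gradient, gradient, hy]

/-- A slice of a jointly smooth function is smooth on `U`. -/
theorem contDiffOn_slice {G : Type*} [NormedAddCommGroup G] [NormedSpace ℝ G] {w : ℝ → E3 → G} {I : Set ℝ}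
    {n : WithTop ℕ∞} (hw : ContDiffOn ℝ n (Function.uncurry w) (I ×ˢ U)) {t : ℝ} (ht : t ∈ I) :
    ContDiffOn ℝ n (w t) U := by
  have h : ContDiffOn ℝ n (Function.uncurry w ∘ fun z : E3 => (t, z)) U :=
    hw.comp (contDiffOn_const.prodMk contDiffOn_id) fun z hz => ⟨ht, hz⟩
  exact h

end Localisation

/-! ### Local forms of the tree's global Laplacian identities -/

section LocalLaplacian

variable {U : Set E3} {x : E3}

/-- **`curl Δ = Δ curl` locally**: for `w` smooth on an open `U ∋ x` (tree: `curl_laplacian` for globally `C³` fields). -/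
theorem curl_laplacian_of_contDiffOn {w : E3 → E3} (hU : IsOpen U) (hw : ContDiffOn ℝ (⊤ : ℕ∞) w U) (hx : x ∈ U) :
    curl (Laplacian.laplacian w) x = Laplacian.laplacian (curl w) x := by
  obtain ⟨g, hg, hfg⟩ := exists_contDiff_eventuallyEq hU hw hx
  have h1 : curl (Laplacian.laplacian w) x = curl (Laplacian.laplacian g) x :=
    (curl_congr_nhds (InnerProductSpace.laplacian_congr_nhds hfg)).eq_of_nhds
  have h2 : Laplacian.laplacian (curl w) x = Laplacian.laplacian (curl g) x :=
    (InnerProductSpace.laplacian_congr_nhds (curl_congr_nhds hfg)).eq_of_nhds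
  rw [h1, h2]
  exact curl_laplacian (hg.of_le (by norm_cast)) x

/-- **Leibniz rule for `Δ⟪F, G⟫` locally** in the standard frame `eᵢ = EuclideanSpace.single i 1`: for `F, G` smooth on an
open `U ∋ x`, `Δ⟪F,G⟫(x) = ⟪ΔF, G⟫ + ⟪F, ΔG⟫ + 2 Σᵢ ⟪∂ᵢF, ∂ᵢG⟫` (tree: `laplacian_inner_eq` for globally `C²` fields). -/
theorem laplacian_inner_of_contDiffOn {F G : E3 → E3} (hU : IsOpen U) (hF : ContDiffOn ℝ (⊤ : ℕ∞) F U)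
    (hG : ContDiffOn ℝ (⊤ : ℕ∞) G U) (hx : x ∈ U) :
    Laplacian.laplacian (fun y => inner ℝ (F y) (G y)) x
      = inner ℝ (Laplacian.laplacian F x) (G x) + inner ℝ (F x) (Laplacian.laplacian G x)
        + 2 * ∑ i : Fin 3, inner ℝ (fderiv ℝ F x (EuclideanSpace.single i 1)) (fderiv ℝ G x (EuclideanSpace.single i 1)) := by
  obtain ⟨f, hf, hFf⟩ := exists_contDiff_eventuallyEq hU hF hx
  obtain ⟨g, hg, hGg⟩ := exists_contDiff_eventuallyEq hU hG hx
  have hfg : (fun y => inner ℝ (F y) (G y)) =ᶠ[𝓝 x] fun y => inner ℝ (f y) (g y) := by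
    filter_upwards [hFf, hGg] with y hy hy'
    rw [hy, hy']
  rw [(InnerProductSpace.laplacian_congr_nhds hfg).eq_of_nhds, (InnerProductSpace.laplacian_congr_nhds hFf).eq_of_nhds,
    (InnerProductSpace.laplacian_congr_nhds hGg).eq_of_nhds, hFf.eq_of_nhds, hGg.eq_of_nhds, hFf.fderiv_eq, hGg.fderiv_eq,
    laplacian_inner_eq (EuclideanSpace.basisFun (Fin 3) ℝ) (hf.of_le (by norm_cast)) (hg.of_le (by norm_cast)) x]
  simp only [EuclideanSpace.basisFun_apply]

/-- **`Δ⟪B, y − x₀⟫ = ⟪ΔB, x − x₀⟫ + 2 div B` locally** (the level-0 Leibniz rule: `∇²(½‖y − x₀‖²) = I`). -/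
theorem laplacian_inner_sub_const_of_contDiffOn {B : E3 → E3} (hU : IsOpen U) (hB : ContDiffOn ℝ (⊤ : ℕ∞) B U)
    (hx : x ∈ U) (x₀ : E3) :
    Laplacian.laplacian (fun y => inner ℝ (B y) (y - x₀)) x
      = inner ℝ (Laplacian.laplacian B x) (x - x₀) + 2 * Literature.Analysis.FluidPDE.VectorCalculus.divergence B x := by
  have hG : ContDiffOn ℝ (⊤ : ℕ∞) (fun y : E3 => y - x₀) U := (contDiff_id.sub contDiff_const).contDiffOn
  rw [laplacian_inner_of_contDiffOn hU hB hG hx]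
  have hΔ : Laplacian.laplacian (fun y : E3 => y - x₀) x = 0 := by
    have h1 : ContDiffAt ℝ 2 (fun y : E3 => y) x := contDiffAt_id
    have h2 : ContDiffAt ℝ 2 (fun _ : E3 => x₀) x := contDiffAt_const
    rw [show (fun y : E3 => y - x₀) = ((fun y : E3 => y) - fun _ : E3 => x₀) from rfl, h1.laplacian_sub h2,
      laplacian_id_eq_zero, laplacian_const_eq_zero, sub_zero]
  have hD : ∀ i : Fin 3, fderiv ℝ (fun y : E3 => y - x₀) x (EuclideanSpace.single i 1) = EuclideanSpace.single i 1 := by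
    intro i
    rw [fderiv_sub_const, fderiv_fun_id]
    rfl
  rw [hΔ, inner_zero_right, add_zero, divergence_eq_sum_inner_fderiv (EuclideanSpace.basisFun (Fin 3) ℝ)]
  simp only [EuclideanSpace.basisFun_apply, hD, real_inner_comm]

/-- Coordinates of the gradient are the partial derivatives: `(∇m)(y) j = Dm(y)[eⱼ]`. -/
theorem gradient_apply_coord (m : E3 → ℝ) (y : E3) (j : Fin 3) :
    gradient m y j = fderiv ℝ m y (EuclideanSpace.single j 1) := by
  have h := InnerProductSpace.toDual_symm_apply (𝕜 := ℝ) (E := E3) (x := EuclideanSpace.single j 1) (y := fderiv ℝ m y)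
  rw [EuclideanSpace.inner_single_right] at h
  simpa [gradient] using h

/-- **`Δ∇ = ∇Δ` locally**: for `m` smooth on an open `U ∋ x`, `Δ(∇m)(x) = ∇(Δm)(x)` (tree: `fderiv_laplacian_apply_of_contDiff_three`,
coordinatewise, after localisation). -/
theorem laplacian_gradient_of_contDiffOn {m : E3 → ℝ} (hU : IsOpen U) (hm : ContDiffOn ℝ (⊤ : ℕ∞) m U) (hx : x ∈ U) :
    Laplacian.laplacian (gradient m) x = gradient (Laplacian.laplacian m) x := by
  obtain ⟨g, hg, hmg⟩ := exists_contDiff_eventuallyEq hU hm hx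
  rw [(InnerProductSpace.laplacian_congr_nhds (gradient_congr_nhds hmg)).eq_of_nhds,
    (gradient_congr_nhds (InnerProductSpace.laplacian_congr_nhds hmg)).eq_of_nhds]
  -- now everything is about the globally smooth `g`
  have hg3 : ContDiff ℝ 3 g := hg.of_le (by norm_cast)
  have hg2 : ContDiff ℝ 2 g := hg.of_le (by norm_cast)
  have hgrad2 : ContDiffAt ℝ 2 (gradient g) x := by
    have h : ContDiff ℝ 2 (fderiv ℝ g) := hg.fderiv_right (m := 2) (by norm_cast)
    exact ((InnerProductSpace.toDual ℝ E3).symm.contDiff.comp h).contDiffAt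
  ext j
  rw [gradient_apply_coord, fderiv_laplacian_apply_of_contDiff_three hg3]
  -- `(Δ ∇g)(x) j = Δ (y ↦ (∇g)(y) j)(x) = Δ (y ↦ Dg(y)[eⱼ])(x)`
  have hproj : (fun y => gradient g y j) = fun y => (EuclideanSpace.proj j : E3 →L[ℝ] ℝ) (gradient g y) := by
    funext y; rfl
  have h1 : (Laplacian.laplacian (gradient g) x) j
      = Laplacian.laplacian (fun y => (EuclideanSpace.proj j : E3 →L[ℝ] ℝ) (gradient g y)) x := by
    have h := hgrad2.laplacian_CLM_comp_left (l := (EuclideanSpace.proj j : E3 →L[ℝ] ℝ))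
    rw [show (fun y => (EuclideanSpace.proj j : E3 →L[ℝ] ℝ) (gradient g y))
        = ((EuclideanSpace.proj j : E3 →L[ℝ] ℝ) ∘ gradient g) from rfl, h]
    rfl
  have h2 : (fun y => (EuclideanSpace.proj j : E3 →L[ℝ] ℝ) (gradient g y)) = fun y => fderiv ℝ g y (EuclideanSpace.single j 1) := by
    funext y
    exact gradient_apply_coord g y j
  rw [show (Laplacian.laplacian (gradient g) x).ofLp j = (Laplacian.laplacian (gradient g) x) j from rfl, h1, h2]

/-- Coordinates commute with the derivative: `(DF(x)[a]) j = D(y ↦ F y j)(x)[a]` for `F` differentiable at `x`. -/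
theorem fderiv_apply_coord {F : E3 → E3} (hF : DifferentiableAt ℝ F x) (a : E3) (j : Fin 3) :
    fderiv ℝ F x a j = fderiv ℝ (fun y => F y j) x a := by
  have h : fderiv ℝ (fun y => (EuclideanSpace.proj j : E3 →L[ℝ] ℝ) (F y)) x
      = (EuclideanSpace.proj j : E3 →L[ℝ] ℝ).comp (fderiv ℝ F x) :=
    ((EuclideanSpace.proj j : E3 →L[ℝ] ℝ).hasFDerivAt.comp x hF.hasFDerivAt).fderiv
  exact (congrArg (fun L : E3 →L[ℝ] ℝ => L a) h).symm

/-- The frame sum of the Leibniz rule in coordinates: `Σᵢ ⟪∂ᵢω, ∂ᵢ(∇m)⟫ = Σᵢⱼ (∂ᵢωⱼ)(∂ᵢ∂ⱼm)`. -/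
theorem sum_inner_fderiv_gradient_eq {ω : E3 → E3} {m : E3 → ℝ} (hω : DifferentiableAt ℝ ω x)
    (hm : DifferentiableAt ℝ (gradient m) x) :
    ∑ i : Fin 3, inner ℝ (fderiv ℝ ω x (EuclideanSpace.single i 1)) (fderiv ℝ (gradient m) x (EuclideanSpace.single i 1))
      = ∑ i : Fin 3, ∑ j : Fin 3,
          (fderiv ℝ (fun z => ω z j) x (EuclideanSpace.single i 1))
            * (fderiv ℝ (fun z => fderiv ℝ m z (EuclideanSpace.single j 1)) x (EuclideanSpace.single i 1)) := by
  refine Finset.sum_congr rfl fun i _ => ?_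
  rw [PiLp.inner_apply]
  refine Finset.sum_congr rfl fun j _ => ?_
  have hgm : (fun z => fderiv ℝ m z (EuclideanSpace.single j 1)) = fun z => gradient m z j := by
    funext z; exact (gradient_apply_coord m z j).symm
  rw [hgm, ← fderiv_apply_coord hω, ← fderiv_apply_coord hm]
  simp [mul_comm]

end LocalLaplacian

end Summit.NavierStokesRegularity.NavierStokesRegularity.Theorems.PoloidalLiouville.ErtelTower
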